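import Mathlib.Analysis.Calculus.MeanValue
import Mathlib.Analysis.Calculus.ContDiff.Basic
import Mathlib.Analysis.Normed.Module.FiniteDimension
import Mathlib.Analysis.SpecialFunctions.Sqrt
import Mathlib.Topology.MetricSpace.Thickening
import HarnessLib

/-!
# Glaeser's inequality: `‖φ'‖ ≤ C √φ` for nonnegative `C²` functions
(topic `Analysis/Calculus`; Hörmander, *ALPDO I*, Lemma 7.7.2; G. Glaeser 1963)

Analysis SUPPORT file (everything proved; no definitions, no named facts) for the named fact
`Literature.Geometry.Riemannian.gurskyViaclovsky_gradientEstimate_weighted_four` (the `C¹`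
estimate of Gursky–Viaclovsky for the `σ₂`-path equation, where the nonnegative weight
`|Weyl_g|²`, read in a chart, has to satisfy `‖d wf‖ ≤ C √wf` on a compact set).

**Glaeser's inequality.** A nonnegative function `φ` of class `C²` with `‖φ''‖ ≤ M` satisfies
`‖φ'(y)‖² ≤ 2 M φ(y)`: the first derivative of a nonnegative `C²` function is controlled by the
SQUARE ROOT of the function. We prove it (with harmless non-sharp constants) in three layers:

* `abs_le_of_forall_quadratic_nonneg` — the algebraic core: if `0 ≤ c + s a + M s²` for all
  `|s| ≤ δ` then `|a| ≤ 2 √(M c) + 2 c / δ` (minimise the quadratic in `s`, or evaluate at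
  `s = ∓δ` when the minimiser leaves `[-δ, δ]`);
* `abs_sub_sub_fderiv_le_of_norm_fderiv_fderiv_le` — the second-order Taylor bound
  `|φ(y + w) - φ(y) - φ'(y) w| ≤ M ‖w‖²` on a ball where `‖φ''‖ ≤ M` (two applications of the
  mean value inequality on convex sets);
* `norm_fderiv_le_of_nonneg_of_norm_fderiv_fderiv_le` — the POINTWISE inequality on a ball:
  `φ ≥ 0` and `‖φ''‖ ≤ M` on `closedBall y δ` give `‖φ'(y)‖ ≤ 2 √(M φ(y)) + 2 φ(y) / δ`;
  `norm_fderiv_le_two_mul_sqrt` — the whole-space form `‖φ'(y)‖ ≤ 2 √(M φ(y))`;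
* `exists_norm_fderiv_le_mul_sqrt` — the COMPACT form consumed downstream: for `φ` of class `C²`
  and nonnegative on an open set `V` of a finite-dimensional space and `K ⊆ V` compact there is
  `C ≥ 0` with `‖φ'(y)‖ ≤ C √(φ(y))` for all `y ∈ K` (thicken `K` inside `V` by
  `IsCompact.exists_cthickening_subset_open`, bound `φ''` on the compact thickening and `φ` on
  `K`, and use `2 φ(y) / δ ≤ (2 √(sup_K φ) / δ) √(φ(y))`).

## References
* [HormanderALPDO1] L. Hörmander, *The Analysis of Linear Partial Differential Operators I*,
  Grundlehren 256, Springer 1983, Lemma 7.7.2.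
* [Glaeser1963] G. Glaeser, Racine carrée d'une fonction différentiable, Ann. Inst. Fourier
  (Grenoble) 13 (1963), no. 2, 203–210.
-/

noncomputable section

open Set Metric

namespace Literature.Analysis.Calculus

/-! ### The algebraic core -/

/-- **Algebraic core of Glaeser's inequality.** If the quadratic `c + s a + M s²` (`M ≥ 0`) is
nonnegative for all `|s| ≤ δ` (`δ > 0`), then `|a| ≤ 2 √(M c) + 2 c / δ`: if `|a| ≤ 2 M δ`
evaluate at the minimiser `s = -a / (2M)` to get `a² ≤ 4 M c`, otherwise at `s = ∓δ` to get
`|a| δ ≤ 2 c`. [folklore] -/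
theorem abs_le_of_forall_quadratic_nonneg {a c M δ : ℝ} (hδ : 0 < δ) (hM : 0 ≤ M)
    (h : ∀ s : ℝ, |s| ≤ δ → 0 ≤ c + s * a + M * s ^ 2) :
    |a| ≤ 2 * Real.sqrt (M * c) + 2 * c / δ := by
  have hc : 0 ≤ c := by simpa using h 0 (by simp [hδ.le])
  have hsq : 0 ≤ Real.sqrt (M * c) := Real.sqrt_nonneg _
  have hcd : 0 ≤ 2 * c / δ := by positivity
  by_cases hle : |a| ≤ 2 * M * δ
  · -- interior case: the minimiser `-a / (2M)` lies in `[-δ, δ]`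
    suffices hsq' : a ^ 2 ≤ 4 * (M * c) by
      have h2 : |a| ≤ 2 * Real.sqrt (M * c) := by
        refine abs_le_of_sq_le_sq ?_ (by positivity)
        rw [mul_pow, Real.sq_sqrt (mul_nonneg hM hc)]
        linarith
      linarith
    rcases hM.eq_or_lt with hM0 | hMpos
    · subst hM0
      have ha : a = 0 := by simpa using hle
      simp [ha]
    · have hs : |-(a / (2 * M))| ≤ δ := by
        rw [abs_neg, abs_div, abs_of_pos (by positivity : (0 : ℝ) < 2 * M),
          div_le_iff₀ (by positivity : (0 : ℝ) < 2 * M)]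
        linarith
      have h1 := h _ hs
      have h2 : c + -(a / (2 * M)) * a + M * (-(a / (2 * M))) ^ 2 = c - a ^ 2 / (4 * M) := by
        field_simp
        ring
      rw [h2, sub_nonneg, div_le_iff₀ (by positivity : (0 : ℝ) < 4 * M)] at h1
      linarith
  · -- boundary case: evaluate at `s = -δ` (`a > 0`) or `s = δ` (`a < 0`)
    rw [not_le] at hle
    have h3 : |a| ≤ 2 * c / δ := by
      rw [le_div_iff₀ hδ]
      rcases le_or_gt 0 a with ha | ha
      · have h1 := h (-δ) (by rw [abs_neg, abs_of_pos hδ])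
        rw [abs_of_nonneg ha] at hle ⊢
        nlinarith [mul_lt_mul_of_pos_right hle hδ]
      · have h1 := h δ (by rw [abs_of_pos hδ])
        rw [abs_of_neg ha] at hle ⊢
        nlinarith [mul_lt_mul_of_pos_right hle hδ]
    linarith

/-! ### The second-order Taylor bound on a ball -/

section Ball

variable {E : Type*} [NormedAddCommGroup E] [NormedSpace ℝ E]

/-- **Second-order Taylor bound from a bound on the second derivative.** If `f` and `fderiv ℝ f`
are differentiable on the closed ball `closedBall y δ` and `‖D²f‖ ≤ M` there, then for
`‖w‖ ≤ δ`: `|f(y + w) - f(y) - Df(y) w| ≤ M ‖w‖²` (mean value inequality for `Df` on the ball,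
`‖Df(z) - Df(y)‖ ≤ M ‖z - y‖`, then for `f - Df(y)` on `closedBall y ‖w‖`). [folklore] -/
theorem abs_sub_sub_fderiv_le_of_norm_fderiv_fderiv_le {f : E → ℝ} {y : E} {δ M : ℝ}
    (hf : ∀ z ∈ closedBall y δ, DifferentiableAt ℝ f z)
    (hf' : ∀ z ∈ closedBall y δ, DifferentiableAt ℝ (fderiv ℝ f) z)
    (hM : ∀ z ∈ closedBall y δ, ‖fderiv ℝ (fderiv ℝ f) z‖ ≤ M) {w : E} (hw : ‖w‖ ≤ δ) :
    |f (y + w) - f y - fderiv ℝ f y w| ≤ M * ‖w‖ ^ 2 := by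
  have hδ : 0 ≤ δ := (norm_nonneg w).trans hw
  have hy : y ∈ closedBall y δ := mem_closedBall_self hδ
  have hM0 : 0 ≤ M := (norm_nonneg (fderiv ℝ (fderiv ℝ f) y)).trans (hM y hy)
  -- first mean value step: `‖Df(z) - Df(y)‖ ≤ M ‖z - y‖` on the ball
  have h1 : ∀ z ∈ closedBall y δ, ‖fderiv ℝ f z - fderiv ℝ f y‖ ≤ M * ‖z - y‖ := fun z hz =>
    (convex_closedBall y δ).norm_image_sub_le_of_norm_fderiv_le hf' hM hy hz
  -- second mean value step for `f - Df(y)` on `closedBall y ‖w‖`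
  have hsub : closedBall y ‖w‖ ⊆ closedBall y δ := closedBall_subset_closedBall hw
  have hyw : y + w ∈ closedBall y ‖w‖ := by simp [mem_closedBall, dist_eq_norm]
  have h2 := (convex_closedBall y ‖w‖).norm_image_sub_le_of_norm_fderiv_le' (𝕜 := ℝ)
    (fun z hz => hf z (hsub hz))
    (fun z hz => (h1 z (hsub hz)).trans
      (mul_le_mul_of_nonneg_left (mem_closedBall_iff_norm.1 hz) hM0))
    (mem_closedBall_self (norm_nonneg w)) hyw
  rw [add_sub_cancel_left, Real.norm_eq_abs] at h2
  calc |f (y + w) - f y - fderiv ℝ f y w| ≤ M * ‖w‖ * ‖w‖ := h2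
    _ = M * ‖w‖ ^ 2 := by ring

/-! ### Glaeser's inequality -/

/-- **Glaeser's inequality, pointwise form on a ball** (Hörmander, ALPDO I, Lemma 7.7.2, up to
the constants). Let `f` and `Df` be differentiable on `closedBall y δ` (`δ > 0`) with
`‖D²f‖ ≤ M` and `f ≥ 0` there. Then `‖Df(y)‖ ≤ 2 √(M f(y)) + 2 f(y) / δ`. Indeed for a unit
vector `v` and `|s| ≤ δ`, `0 ≤ f(y + s v) ≤ f(y) + s Df(y) v + M s²`, and the algebraic core
applies. [cite: HormanderALPDO1, Lemma 7.7.2] -/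
theorem norm_fderiv_le_of_nonneg_of_norm_fderiv_fderiv_le {f : E → ℝ} {y : E} {δ M : ℝ}
    (hδ : 0 < δ) (hf : ∀ z ∈ closedBall y δ, DifferentiableAt ℝ f z)
    (hf' : ∀ z ∈ closedBall y δ, DifferentiableAt ℝ (fderiv ℝ f) z)
    (hM : ∀ z ∈ closedBall y δ, ‖fderiv ℝ (fderiv ℝ f) z‖ ≤ M)
    (h0 : ∀ z ∈ closedBall y δ, 0 ≤ f z) :
    ‖fderiv ℝ f y‖ ≤ 2 * Real.sqrt (M * f y) + 2 * f y / δ := by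
  have hy : y ∈ closedBall y δ := mem_closedBall_self hδ.le
  have hM0 : 0 ≤ M := (norm_nonneg (fderiv ℝ (fderiv ℝ f) y)).trans (hM y hy)
  have hc : 0 ≤ f y := h0 y hy
  refine ContinuousLinearMap.opNorm_le_of_unit_norm (by positivity) fun v hv => ?_
  rw [Real.norm_eq_abs]
  refine abs_le_of_forall_quadratic_nonneg hδ hM0 fun s hs => ?_
  have hw : ‖s • v‖ ≤ δ := by rw [norm_smul, hv, mul_one, Real.norm_eq_abs]; exact hs
  have h1 := abs_sub_sub_fderiv_le_of_norm_fderiv_fderiv_le hf hf' hM hw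
  have h2 : 0 ≤ f (y + s • v) :=
    h0 _ (mem_closedBall_iff_norm.2 (by rwa [add_sub_cancel_left]))
  rw [map_smul, smul_eq_mul, norm_smul, hv, mul_one, Real.norm_eq_abs, sq_abs] at h1
  linarith [(abs_le.1 h1).2]

/-- **Glaeser's inequality, whole-space form**: a nonnegative `C²` function `f : E → ℝ` with
`‖D²f‖ ≤ M` everywhere satisfies `‖Df(y)‖ ≤ 2 √(M f(y))`, i.e. `‖Df‖² ≤ 4 M f` (the sharp
constant is `2 M f`; let `δ → ∞` in the pointwise form). [cite: HormanderALPDO1, Lemma 7.7.2] -/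
theorem norm_fderiv_le_two_mul_sqrt {f : E → ℝ} {M : ℝ} (hf : ContDiff ℝ 2 f)
    (hM : ∀ z, ‖fderiv ℝ (fderiv ℝ f) z‖ ≤ M) (h0 : ∀ z, 0 ≤ f z) (y : E) :
    ‖fderiv ℝ f y‖ ≤ 2 * Real.sqrt (M * f y) := by
  have hd : ∀ z, DifferentiableAt ℝ f z := fun z => (hf.differentiable (by norm_num)) z
  have hd' : ∀ z, DifferentiableAt ℝ (fderiv ℝ f) z := fun z =>
    ((hf.fderiv_right (m := 1) (by norm_num)).differentiable one_ne_zero) z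
  refine le_of_forall_pos_le_add fun ε hε => ?_
  have hy : 0 ≤ f y := h0 y
  have hδ : 0 < 2 * f y / ε + 1 := by positivity
  have h := norm_fderiv_le_of_nonneg_of_norm_fderiv_fderiv_le (y := y) hδ (fun z _ => hd z)
    (fun z _ => hd' z) (fun z _ => hM z) (fun z _ => h0 z)
  have key : ε * (2 * f y / ε + 1) = 2 * f y + ε := by
    field_simp
  have hε' : 2 * f y / (2 * f y / ε + 1) ≤ ε := by
    rw [div_le_iff₀ hδ]
    linarith
  linarith

end Ball

/-! ### Glaeser's inequality on compact subsets of an open set -/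

/-- **Glaeser's inequality on compact subsets** (Hörmander, ALPDO I, Lemma 7.7.2, localised).
Let `E` be a finite-dimensional real normed space, `V ⊆ E` open, `K ⊆ V` compact, and
`φ : E → ℝ` of class `C²` on `V` and nonnegative on `V`. Then there is a constant `C ≥ 0` with
`‖Dφ(y)‖ ≤ C √(φ(y))` for all `y ∈ K`. Proof: choose `δ > 0` with the closed
`δ`-thickening `K'` of `K` inside `V`; `K'` is compact, so `‖D²φ‖ ≤ M` on `K'` and `φ ≤ M₀` on
`K`; for `y ∈ K` the ball `closedBall y δ ⊆ K'`, and the pointwise form gives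
`‖Dφ(y)‖ ≤ 2 √(M φ(y)) + 2 φ(y) / δ ≤ (2 √M + 2 √M₀ / δ) √(φ(y))`.
[cite: HormanderALPDO1, Lemma 7.7.2] -/
theorem exists_norm_fderiv_le_mul_sqrt {E : Type*} [NormedAddCommGroup E] [NormedSpace ℝ E]
    [FiniteDimensional ℝ E] {φ : E → ℝ} {V K : Set E} (hV : IsOpen V) (hK : IsCompact K)
    (hKV : K ⊆ V) (hφ : ContDiffOn ℝ 2 φ V) (hφ0 : ∀ y ∈ V, 0 ≤ φ y) :
    ∃ C : ℝ, 0 ≤ C ∧ ∀ y ∈ K, ‖fderiv ℝ φ y‖ ≤ C * Real.sqrt (φ y) := by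
  obtain ⟨δ, hδ, hδV⟩ := hK.exists_cthickening_subset_open hV hKV
  have hK' : IsCompact (cthickening δ K) := hK.cthickening
  have hdiff : ∀ z ∈ V, DifferentiableAt ℝ φ z := fun z hz =>
    (hφ.differentiableOn (by norm_num) z hz).differentiableAt (hV.mem_nhds hz)
  have hφ' : ContDiffOn ℝ 1 (fderiv ℝ φ) V := hφ.fderiv_of_isOpen hV (by norm_num)
  have hdiff' : ∀ z ∈ V, DifferentiableAt ℝ (fderiv ℝ φ) z := fun z hz =>
    (hφ'.differentiableOn one_ne_zero z hz).differentiableAt (hV.mem_nhds hz)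
  have hcont : ContinuousOn (fderiv ℝ (fderiv ℝ φ)) V :=
    hφ'.continuousOn_fderiv_of_isOpen hV le_rfl
  have hcont' : ContinuousOn (fderiv ℝ (fderiv ℝ φ)) (cthickening δ K) := hcont.mono hδV
  obtain ⟨M₁, hM₁⟩ := hK'.exists_bound_of_continuousOn (f := fderiv ℝ (fderiv ℝ φ)) hcont'
  have hcont₀ : ContinuousOn φ K := hφ.continuousOn.mono hKV
  obtain ⟨M₀, hM₀⟩ := hK.exists_bound_of_continuousOn (f := φ) hcont₀
  have hM : 0 ≤ max M₁ 0 := le_max_right _ _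
  refine ⟨2 * Real.sqrt (max M₁ 0) + 2 * Real.sqrt (max M₀ 0) / δ, by positivity,
    fun y hy => ?_⟩
  have hballK' : closedBall y δ ⊆ cthickening δ K := closedBall_subset_cthickening hy δ
  have hball : closedBall y δ ⊆ V := hballK'.trans hδV
  have hc : 0 ≤ φ y := hφ0 y (hKV hy)
  have hcM₀ : φ y ≤ max M₀ 0 := by
    have h := hM₀ y hy
    rw [Real.norm_eq_abs] at h
    exact ((le_abs_self _).trans h).trans (le_max_left _ _)
  have h := norm_fderiv_le_of_nonneg_of_norm_fderiv_fderiv_le (M := max M₁ 0) hδ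
    (fun z hz => hdiff z (hball hz)) (fun z hz => hdiff' z (hball hz))
    (fun z hz => (hM₁ z (hballK' hz)).trans (le_max_left M₁ 0)) (fun z hz => hφ0 z (hball hz))
  refine h.trans ?_
  rw [Real.sqrt_mul hM, add_mul]
  have h1 : φ y ≤ Real.sqrt (max M₀ 0) * Real.sqrt (φ y) := by
    calc φ y = Real.sqrt (φ y) * Real.sqrt (φ y) := (Real.mul_self_sqrt hc).symm
      _ ≤ Real.sqrt (max M₀ 0) * Real.sqrt (φ y) := by gcongr
  have h2 : 2 * φ y / δ ≤ 2 * Real.sqrt (max M₀ 0) / δ * Real.sqrt (φ y) := by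
    rw [div_mul_eq_mul_div, div_le_div_iff_of_pos_right hδ]
    linarith
  linarith

end Literature.Analysis.Calculus
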